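import Mathlib
import HarnessLib
import Summits.HodgeConjecture.HodgeConjecture.Theses.PadicSemiregularLift
import Literature.AlgebraicGeometry.KTheory.GrothendieckGroup
import Literature.AlgebraicGeometry.HodgeTheory.SemiregularityObstructionBridge
import Summits.HodgeConjecture.HodgeConjecture.Theorems.PadicSemiregularLiftPadicPridhamSemiregularityThickeningMapFirstOrder
import Summits.HodgeConjecture.HodgeConjecture.Theorems.PadicSemiregularLiftPadicPridhamSemiregularitySpecialFibreClosedImmersion
import Summits.HodgeConjecture.HodgeConjecture.Theorems.PadicSemiregularLiftPadicPridhamSemiregularityConormalSheafThickeningMap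
import Summits.HodgeConjecture.HodgeConjecture.Theorems.PadicSemiregularLiftPadicPridhamSemiregularitySemiregularOfIso

/-!
# `PadicPridhamSemiregularity` (stmt-HodgeConjecture-13815) from the Illusie obstruction package

The crux P1b of route `HodgeConjecture/PadicSemiregularLift`, TYPED 2026-08-16 (route rev 11–13) as
"`{0,1}`-semiregular finite locally free `E₁` on the special fibre of a smooth proper `𝒳/W(k)` satisfy (⋆)
CLASS-LIFTS-IMPLY-OBJECT-LIFTS at every level of the `p`-adic tower", is reduced here — kernel-checked, over the
tree's real carriers — to ONE hypothesis, the **Illusie obstruction package** (stub H of line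
`sigma-ob-kzero-additivity`, lead prover-line-stmt-HodgeConjecture-13815-0): across a first-order thickening
`i : Z₀ ↪ Z₁` whose conormal sheaf is `j_*𝒪_Y` for a closed immersion `j : Y ↪ Z₀`, there is an obstruction map
`Ob : VB(Z₀) → Ext²_Y(j^*F, j^*F ⊗ 𝒪_Y)` which (B) vanishes iff the bundle lifts (The Stacks project Tag 08VR (1),
read on `Y` by Lieblich's cher-à-Cartan isomorphism) and (A) has `σ₀ ∘ Ob`, `σ₁ ∘ Ob` ADDITIVE over short exact
sequences (Buchweitz–Flenner-type trace additivity; paper proof by filtered Čech cocycles). Everything else the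
line needs is LANDED and used here by import: the tower geometry G1 (`stub_thickeningMap_firstOrder`), G2
(`stub_specialFibreToThickening_closedImmersion`), G3 (`stub_conormalSheaf_thickeningMap`, flatness of smooth
`𝒳/W`) and T (`stub_isZeroOneSemiregular_of_iso`).

Mechanism (= Cruxes/PadicPridhamSemiregularity/Disproof.lean §1 Finding 1, re-cut on real carriers): the
invariant `Φ(F) := (σ₀(Ob F), σ₁(Ob F)) ∈ H²(X_k, 𝒪) × H³(X_k, Ω¹)` is additive by (A), hence factors through
Fulton's `K₀(X_{n+1})` (`KZero.lift`), and vanishes on restrictions from `X_{n+2}` by (B); so it kills every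
bundle whose class lifts (`vanishes_of_classLifts_kZero`); `{0,1}`-semiregularity of `E₁ ≅ j^*F` (transported
by T, read on the obstruction group by `isZeroOneSemiregular_iff_obstruction`) then forces `Ob F = 0`, and (B)
gives the lift. No defs in this file; the hypothesis is stated inline (it is the registered stub
`stub_illusieObstructionAdditive` verbatim), so this is a plain theorem `H → crux`, closing the crux the moment a
proof of `H` lands.
-/

noncomputable section

open CategoryTheory AlgebraicGeometry
open Literature.AlgebraicGeometry.Motives Literature.AlgebraicGeometry.Motives.WittScheme
  Literature.AlgebraicGeometry.KTheory Literature.AlgebraicGeometry.Deformation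
  Literature.AlgebraicGeometry.HodgeTheory Literature.AlgebraicGeometry.Modules

-- the mandated namespace `Summit.HodgeConjecture.HodgeConjecture.…` repeats a component
set_option linter.dupNamespace false

namespace Summit.HodgeConjecture.HodgeConjecture.Theorems.PadicPridhamSemiregularity

section Glue

variable {Y Z : Scheme.{0}} (f : Y ⟶ Z) {A : Type*} [AddCommGroup A]

/-- **K₀-FACTORISATION PRINCIPLE** (Fulton §15.1 universal property = tree `KZero.lift` / `KZero.hom_ext`): an
invariant of vector bundles on `Y` that is additive on short exact sequences and vanishes on pull-backs `f^*G`
vanishes on every bundle whose `K₀`-class is pulled back from `Z`. [cite: Fulton1998, §15.1] -/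
theorem vanishes_of_classLifts_kZero (Φ : ∀ F : Y.Modules, IsFiniteLocallyFree F → A)
    (hadd : ∀ (S : ShortComplex Y.Modules), S.ShortExact → ∀ (h₁ : IsFiniteLocallyFree S.X₁)
      (h₂ : IsFiniteLocallyFree S.X₂) (h₃ : IsFiniteLocallyFree S.X₃), Φ S.X₂ h₂ = Φ S.X₁ h₁ + Φ S.X₃ h₃)
    (hvan : ∀ (G : Z.Modules) (hG : IsFiniteLocallyFree G),
      Φ ((Scheme.Modules.pullback f).obj G) (hG.pullback f) = 0)
    (F : Y.Modules) (hF : IsFiniteLocallyFree F) (hcls : ∃ y : KZero Z, KZero.map f y = KZero.of F hF) :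
    Φ F hF = 0 := by
  obtain ⟨y, hy⟩ := hcls
  have hcomp : (KZero.lift Φ hadd).comp (KZero.map f) = 0 :=
    KZero.hom_ext fun G hG => by
      simp only [AddMonoidHom.comp_apply, KZero.map_of, KZero.lift_of, AddMonoidHom.zero_apply]
      exact hvan G hG
  rw [← KZero.lift_of Φ hadd F hF, ← hy, ← AddMonoidHom.comp_apply, hcomp, AddMonoidHom.zero_apply]

end Glue

/-- **The crux `PadicPridhamSemiregularity` from the Illusie obstruction package.** Hypothesis = stub H of line
`sigma-ob-kzero-additivity` verbatim (∃ an obstruction map read on the base with the lifting criterion (B) and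
additivity (A) of `σ₀ ∘ Ob`, `σ₁ ∘ Ob`); conclusion = the route decl
`PadicSemiregularLift.PadicPridhamSemiregularity` (stmt-HodgeConjecture-13815). Uses the landed stubs G1–G3, T.
[folklore] -/
theorem padicPridhamSemiregularity_of_obstructionAdditive :
    (∀ (k : Type) [CommRing k] (Y : Literature.AlgebraicGeometry.Motives.SchemeOver k) (Z₀ Z₁ :
      AlgebraicGeometry.Scheme.{0}) (j : Y.left ⟶ Z₀) [AlgebraicGeometry.IsClosedImmersion j] (i : Z₀ ⟶ Z₁)
      [Literature.AlgebraicGeometry.Deformation.IsFirstOrderThickening i],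
      (Literature.AlgebraicGeometry.Deformation.conormalSheaf i ≅
      (AlgebraicGeometry.Scheme.Modules.pushforward j).obj (Literature.AlgebraicGeometry.Modules.unitModule
      Y.left)) → ∃ Ob : ∀ (F : Z₀.Modules), Literature.AlgebraicGeometry.Motives.IsFiniteLocallyFree F →
      Literature.AlgebraicGeometry.Deformation.obstructionGroup 2
      ((AlgebraicGeometry.Scheme.Modules.pullback j).obj F) (Literature.AlgebraicGeometry.Modules.unitModule
      Y.left), (∀ (F : Z₀.Modules) (hF : Literature.AlgebraicGeometry.Motives.IsFiniteLocallyFree F), Ob F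
      hF = 0 ↔ ∃ F' : Z₁.Modules, Literature.AlgebraicGeometry.Motives.IsFiniteLocallyFree F' ∧ Nonempty
      ((AlgebraicGeometry.Scheme.Modules.pullback i).obj F' ≅ F)) ∧ (∀ (S : CategoryTheory.ShortComplex
      Z₀.Modules), S.ShortExact → ∀ (h₁ : Literature.AlgebraicGeometry.Motives.IsFiniteLocallyFree S.X₁) (h₂
      : Literature.AlgebraicGeometry.Motives.IsFiniteLocallyFree S.X₂) (h₃ :
      Literature.AlgebraicGeometry.Motives.IsFiniteLocallyFree S.X₃),
      Literature.AlgebraicGeometry.HodgeTheory.sigmaZeroObstruction (h₂.pullback j) (Ob S.X₂ h₂) =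
      Literature.AlgebraicGeometry.HodgeTheory.sigmaZeroObstruction (h₁.pullback j) (Ob S.X₁ h₁) +
      Literature.AlgebraicGeometry.HodgeTheory.sigmaZeroObstruction (h₃.pullback j) (Ob S.X₃ h₃) ∧
      Literature.AlgebraicGeometry.HodgeTheory.sigmaOneObstruction (h₂.pullback j) (Ob S.X₂ h₂) =
      Literature.AlgebraicGeometry.HodgeTheory.sigmaOneObstruction (h₁.pullback j) (Ob S.X₁ h₁) +
      Literature.AlgebraicGeometry.HodgeTheory.sigmaOneObstruction (h₃.pullback j) (Ob S.X₃ h₃))) →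
      Summit.HodgeConjecture.HodgeConjecture.Theses.PadicSemiregularLift.PadicPridhamSemiregularity := by
  intro hH p _ k _ _ _ d 𝒳 h𝒳 E₁ hE₁ hsr n F hF hE hcls
  obtain ⟨e⟩ := hE
  haveI : IsFirstOrderThickening (thickeningMap 𝒳 (Nat.le_succ (n + 1))) :=
    stub_thickeningMap_firstOrder p k 𝒳 n
  haveI : IsClosedImmersion (specialFibreToThickening 𝒳 n) :=
    stub_specialFibreToThickening_closedImmersion p k 𝒳 n
  obtain ⟨eI⟩ := stub_conormalSheaf_thickeningMap p k d 𝒳 h𝒳 n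
  obtain ⟨Ob, hdet, hadd⟩ :=
    hH k (specialFibre 𝒳) (thickening 𝒳 (n + 1)).left (thickening 𝒳 (n + 2)).left
      (specialFibreToThickening 𝒳 n) (thickeningMap 𝒳 (Nat.le_succ (n + 1))) eI
  -- the additive invariant `Φ = (σ₀ ∘ Ob, σ₁ ∘ Ob)` with values in `H²(X_k, 𝒪) × H³(X_k, Ω¹)`
  let Φ : ∀ G : (thickening 𝒳 (n + 1)).left.Modules, IsFiniteLocallyFree G →
      structureSheafCohomology (specialFibre 𝒳).left 2 × hodgeCohomologyOne (specialFibre 𝒳) 3 :=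
    fun G hG => (sigmaZeroObstruction (hG.pullback (specialFibreToThickening 𝒳 n)) (Ob G hG),
      sigmaOneObstruction (hG.pullback (specialFibreToThickening 𝒳 n)) (Ob G hG))
  have hΦadd : ∀ (S : ShortComplex (thickening 𝒳 (n + 1)).left.Modules), S.ShortExact →
      ∀ (h₁ : IsFiniteLocallyFree S.X₁) (h₂ : IsFiniteLocallyFree S.X₂) (h₃ : IsFiniteLocallyFree S.X₃),
        Φ S.X₂ h₂ = Φ S.X₁ h₁ + Φ S.X₃ h₃ := by
    intro S hS h₁ h₂ h₃
    obtain ⟨h0, h1⟩ := hadd S hS h₁ h₂ h₃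
    simp only [Φ, Prod.mk_add_mk, Prod.mk.injEq]
    exact ⟨h0, h1⟩
  have hΦvan : ∀ (G : (thickening 𝒳 (n + 2)).left.Modules) (hG' : IsFiniteLocallyFree G),
      Φ ((Scheme.Modules.pullback (thickeningMap 𝒳 (Nat.le_succ (n + 1)))).obj G)
        (hG'.pullback (thickeningMap 𝒳 (Nat.le_succ (n + 1)))) = 0 := by
    intro G hG'
    have h0 : Ob _ (hG'.pullback (thickeningMap 𝒳 (Nat.le_succ (n + 1)))) = 0 :=
      (hdet _ _).mpr ⟨G, hG', ⟨Iso.refl _⟩⟩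
    simp only [Φ, h0, map_zero, Prod.mk_zero_zero]
  have hΦF : Φ F hF = 0 := vanishes_of_classLifts_kZero _ Φ hΦadd hΦvan F hF hcls
  -- `{0,1}`-semiregularity of `j^*F ≅ E₁` (stub T, landed)
  have hsrF : IsZeroOneSemiregular (hF.pullback (specialFibreToThickening 𝒳 n)) :=
    stub_isZeroOneSemiregular_of_iso k (specialFibre 𝒳) E₁ _ e.symm hE₁
      (hF.pullback (specialFibreToThickening 𝒳 n)) hsr
  have hOb : Ob F hF = 0 :=
    (isZeroOneSemiregular_iff_obstruction (hF.pullback (specialFibreToThickening 𝒳 n))).mp hsrF (Ob F hF)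
      (congrArg Prod.fst hΦF) (congrArg Prod.snd hΦF)
  exact (hdet F hF).mp hOb

/-! ## The separated / ideal form H′ (registered reshaped heart, 2026-08-16T09:36Z)

APPENDED (seat prover-…-PadicSemiregularLift-0, integrator of H): the same composition for the RESHAPED stub
H′ = `stub_illusieObstructionAdditiveSep` of `Cruxes/PadicPridhamSemiregularity/Lines/sigma-ob-kzero-additivity.lean`
(registered skeleton check 09:36Z): H with (a) `Z₁` SEPARATED and (b) the coefficient identification at the level of
the IDEAL, `eI : i_* j_* 𝒪_Y ≅ 𝓘` (the form consumed by `Deformation/IdealSectionsTransport.lean` and the whole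
Čech obstruction pipeline `Deformation/DefectCochain.lean` … `Deformation/LiftOfVanishingClass.lean`). In the tower
both are available: `X_{n+2}` is proper (base change of `𝒳 → Spec W`) hence separated over an affine base, and
(b) is G3′ below, proved from the internals of the landed G3 file (`epi_restrictToSpecial`,
`kernel_ι_comp_mulToIdeal`, `isIso_desc`). -/

/-- **G3′ (ideal form of G3)**: for a smooth proper model, `i_* j_* 𝒪_{X_k} ≅ 𝓘 = Ker(i♯)` for
`i : X_{n+1} ↪ X_{n+2}`, `j : X_k ↪ X_{n+1}` — the descent `ν` of `p^{n+1}·` along `ρ : 𝒪 ↠ i_* j_* 𝒪` is an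
isomorphism onto the kernel. [folklore] -/
theorem idealModule_thickeningMap (p : ℕ) [Fact p.Prime] (k : Type) [Field k] [CharP k p] [PerfectRing k p]
    (d : ℕ) (𝒳 : SchemeOver (WittVector p k)) (h𝒳 : IsSmoothProperModel d 𝒳) (n : ℕ) :
    Nonempty ((Scheme.Modules.pushforward (thickeningMap 𝒳 (Nat.le_succ (n + 1)))).obj
        ((Scheme.Modules.pushforward (specialFibreToThickening 𝒳 n)).obj
          (unitModule (specialFibre 𝒳).left)) ≅
      idealModule (thickeningMap 𝒳 (Nat.le_succ (n + 1)))) := by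
  haveI := epi_restrictToSpecial 𝒳 n
  obtain ⟨ν, hν⟩ : ∃ ν, (structureModuleMap (thickeningMap 𝒳 (Nat.le_succ (n + 1))) ≫
      (Scheme.Modules.pushforward (thickeningMap 𝒳 (Nat.le_succ (n + 1)))).map
        (structureModuleMap (specialFibreToThickening 𝒳 n))) ≫ ν =
      Limits.kernel.lift (structureModuleMap (thickeningMap 𝒳 (Nat.le_succ (n + 1))))
        ((p ^ (n + 1)) • 𝟙 (unitModule (thickening 𝒳 (n + 2)).left)) (nsmul_id_comp_structureModuleMap 𝒳 n) :=
    ⟨_, Abelian.comp_epiDesc _ _ (kernel_ι_comp_mulToIdeal 𝒳 n)⟩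
  haveI := isIso_desc hν h𝒳
  exact ⟨asIso ν⟩

/-- **The crux `PadicPridhamSemiregularity` from the SEPARATED / IDEAL form H′ of the obstruction package.**
Hypothesis = the registered stub `stub_illusieObstructionAdditiveSep` verbatim; conclusion = the route decl
(stmt-HodgeConjecture-13815). Uses G1, G2, G3′, T and the K₀-factorisation exactly as
`padicPridhamSemiregularity_of_obstructionAdditive`. [folklore] -/
theorem padicPridhamSemiregularity_of_obstructionAdditiveSep :
    (∀ (k : Type) [CommRing k] (Y : Literature.AlgebraicGeometry.Motives.SchemeOver k)
      (Z₀ Z₁ : AlgebraicGeometry.Scheme.{0}) (j : Y.left ⟶ Z₀) [AlgebraicGeometry.IsClosedImmersion j]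
      (i : Z₀ ⟶ Z₁) [Literature.AlgebraicGeometry.Deformation.IsFirstOrderThickening i] [Z₁.IsSeparated],
      ((AlgebraicGeometry.Scheme.Modules.pushforward i).obj
          ((AlgebraicGeometry.Scheme.Modules.pushforward j).obj
            (Literature.AlgebraicGeometry.Modules.unitModule Y.left)) ≅
        Literature.AlgebraicGeometry.Deformation.idealModule i) →
      ∃ Ob : ∀ (F : Z₀.Modules), Literature.AlgebraicGeometry.Motives.IsFiniteLocallyFree F →
          Literature.AlgebraicGeometry.Deformation.obstructionGroup 2
            ((AlgebraicGeometry.Scheme.Modules.pullback j).obj F)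
            (Literature.AlgebraicGeometry.Modules.unitModule Y.left),
        (∀ (F : Z₀.Modules) (hF : Literature.AlgebraicGeometry.Motives.IsFiniteLocallyFree F),
          Ob F hF = 0 ↔ ∃ F' : Z₁.Modules, Literature.AlgebraicGeometry.Motives.IsFiniteLocallyFree F' ∧
            Nonempty ((AlgebraicGeometry.Scheme.Modules.pullback i).obj F' ≅ F)) ∧
        (∀ (S : CategoryTheory.ShortComplex Z₀.Modules), S.ShortExact →
          ∀ (h₁ : Literature.AlgebraicGeometry.Motives.IsFiniteLocallyFree S.X₁)
            (h₂ : Literature.AlgebraicGeometry.Motives.IsFiniteLocallyFree S.X₂)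
            (h₃ : Literature.AlgebraicGeometry.Motives.IsFiniteLocallyFree S.X₃),
          Literature.AlgebraicGeometry.HodgeTheory.sigmaZeroObstruction (h₂.pullback j) (Ob S.X₂ h₂) =
              Literature.AlgebraicGeometry.HodgeTheory.sigmaZeroObstruction (h₁.pullback j) (Ob S.X₁ h₁) +
                Literature.AlgebraicGeometry.HodgeTheory.sigmaZeroObstruction (h₃.pullback j) (Ob S.X₃ h₃) ∧
            Literature.AlgebraicGeometry.HodgeTheory.sigmaOneObstruction (h₂.pullback j) (Ob S.X₂ h₂) =
              Literature.AlgebraicGeometry.HodgeTheory.sigmaOneObstruction (h₁.pullback j) (Ob S.X₁ h₁) +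
                Literature.AlgebraicGeometry.HodgeTheory.sigmaOneObstruction (h₃.pullback j) (Ob S.X₃ h₃))) →
      Summit.HodgeConjecture.HodgeConjecture.Theses.PadicSemiregularLift.PadicPridhamSemiregularity := by
  intro hH p _ k _ _ _ d 𝒳 h𝒳 E₁ hE₁ hsr n F hF hE hcls
  obtain ⟨e⟩ := hE
  haveI : IsFirstOrderThickening (thickeningMap 𝒳 (Nat.le_succ (n + 1))) :=
    stub_thickeningMap_firstOrder p k 𝒳 n
  haveI : IsClosedImmersion (specialFibreToThickening 𝒳 n) :=
    stub_specialFibreToThickening_closedImmersion p k 𝒳 n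
  -- `X_{n+2}` is separated: it is proper (base change of the proper `𝒳 → Spec W`) over an affine base
  haveI : IsSeparated (thickening 𝒳 (n + 2)).hom := by
    haveI : IsProper 𝒳.hom := h𝒳.isProper
    change IsSeparated (Limits.pullback.snd 𝒳.hom _)
    infer_instance
  haveI : (thickening 𝒳 (n + 2)).left.IsSeparated := by
    constructor
    rw [show Limits.terminal.from (thickening 𝒳 (n + 2)).left =
        (thickening 𝒳 (n + 2)).hom ≫ Limits.terminal.from _ from Limits.terminal.hom_ext _ _]
    infer_instance
  obtain ⟨eI⟩ := idealModule_thickeningMap p k d 𝒳 h𝒳 n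
  obtain ⟨Ob, hdet, hadd⟩ :=
    hH k (specialFibre 𝒳) (thickening 𝒳 (n + 1)).left (thickening 𝒳 (n + 2)).left
      (specialFibreToThickening 𝒳 n) (thickeningMap 𝒳 (Nat.le_succ (n + 1))) eI
  -- the additive invariant `Φ = (σ₀ ∘ Ob, σ₁ ∘ Ob)` with values in `H²(X_k, 𝒪) × H³(X_k, Ω¹)`
  let Φ : ∀ G : (thickening 𝒳 (n + 1)).left.Modules, IsFiniteLocallyFree G →
      structureSheafCohomology (specialFibre 𝒳).left 2 × hodgeCohomologyOne (specialFibre 𝒳) 3 :=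
    fun G hG => (sigmaZeroObstruction (hG.pullback (specialFibreToThickening 𝒳 n)) (Ob G hG),
      sigmaOneObstruction (hG.pullback (specialFibreToThickening 𝒳 n)) (Ob G hG))
  have hΦadd : ∀ (S : ShortComplex (thickening 𝒳 (n + 1)).left.Modules), S.ShortExact →
      ∀ (h₁ : IsFiniteLocallyFree S.X₁) (h₂ : IsFiniteLocallyFree S.X₂) (h₃ : IsFiniteLocallyFree S.X₃),
        Φ S.X₂ h₂ = Φ S.X₁ h₁ + Φ S.X₃ h₃ := by
    intro S hS h₁ h₂ h₃
    obtain ⟨h0, h1⟩ := hadd S hS h₁ h₂ h₃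
    simp only [Φ, Prod.mk_add_mk, Prod.mk.injEq]
    exact ⟨h0, h1⟩
  have hΦvan : ∀ (G : (thickening 𝒳 (n + 2)).left.Modules) (hG' : IsFiniteLocallyFree G),
      Φ ((Scheme.Modules.pullback (thickeningMap 𝒳 (Nat.le_succ (n + 1)))).obj G)
        (hG'.pullback (thickeningMap 𝒳 (Nat.le_succ (n + 1)))) = 0 := by
    intro G hG'
    have h0 : Ob _ (hG'.pullback (thickeningMap 𝒳 (Nat.le_succ (n + 1)))) = 0 :=
      (hdet _ _).mpr ⟨G, hG', ⟨Iso.refl _⟩⟩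
    simp only [Φ, h0, map_zero, Prod.mk_zero_zero]
  have hΦF : Φ F hF = 0 := vanishes_of_classLifts_kZero _ Φ hΦadd hΦvan F hF hcls
  -- `{0,1}`-semiregularity of `j^*F ≅ E₁` (stub T, landed)
  have hsrF : IsZeroOneSemiregular (hF.pullback (specialFibreToThickening 𝒳 n)) :=
    stub_isZeroOneSemiregular_of_iso k (specialFibre 𝒳) E₁ _ e.symm hE₁
      (hF.pullback (specialFibreToThickening 𝒳 n)) hsr
  have hOb : Ob F hF = 0 :=
    (isZeroOneSemiregular_iff_obstruction (hF.pullback (specialFibreToThickening 𝒳 n))).mp hsrF (Ob F hF)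
      (congrArg Prod.fst hΦF) (congrArg Prod.snd hΦF)
  exact (hdet F hF).mp hOb

end Summit.HodgeConjecture.HodgeConjecture.Theorems.PadicPridhamSemiregularity

end
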